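import Mathlib
import Summits.ValiantsHypothesis.ValiantsHypothesis.Theorems.DetQPDetqpThesisStubStabH
import Summits.ValiantsHypothesis.ValiantsHypothesis.Theorems.DetQPDetqpThesisStubTorusLimitGeneral
import Summits.ValiantsHypothesis.ValiantsHypothesis.Theorems.DetQPDetqpThesisHyperdetBorelFixed
import Summits.ValiantsHypothesis.ValiantsHypothesis.Theorems.DetQPDetqpThesisHyperdetWeightH
import Summits.ValiantsHypothesis.ValiantsHypothesis.Theorems.DetQPDetqpThesisHyperdetCalibrationBorder

/-!
# Crux `DetQP.DetqpThesis` (stmt-ValiantsHypothesis-0315), line `four-dimensional-determinant` —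
# calibration of stub C, part 2d (final): **the bet C is EQUIVALENT to `GCTMult.GctThesis`**

With B1 (`stub_sequentialApolarity`), B2 (from B2w `hd_weightH` + `stub_stabH` +
`stub_torusLimit_general` + `hd_borelFixed_of_parts`, all LANDED) and the converse
`hdc_mem_of_fixedWitness`, an `H(n,m,ι)`-stable witness exists iff `X₀₀^{m-n} H_n(X_ι) ∈ Δ(det_m)`;
so the line's bet C (`stub_noFixedWitnessQP`) is the border thesis for `H`, which part 2c proved
equivalent to `GCTMult.GctThesis` (crux stmt-ValiantsHypothesis-0323 of route GCTMult):

* `hdc2_borelFixedWitness` (B2w as a hypothesis `hW`) and `hd_borelFixedWitness` (unconditional: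
  the crux-plan's stub `stub_borelFixedWitness`, statement verbatim) — B2;
* `hdc2_hdBorderThesis_imp_noFixedWitnessQP`, `hdc2_noFixedWitnessQP_imp_hdBorderThesis` (mod `hW`);
* `hdc2_noFixedWitnessQP_iff_gctThesis` (mod `hW`), `hd_fixedWitness_iff_mem`, and
  **`hd_noFixedWitnessQP_iff_gctThesis` — C ⇔ GctThesis, unconditionally**: the line
  `four-dimensional-determinant` reduces the crux to EXACTLY crux 0323; its added content is the
  `H`-stability normal form for a future proof, not a logically weaker target.
Folklore assembly of parts 1, 2a–2c and the landed stubs.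
-/

open MvPolynomial
open scoped BigOperators Matrix

namespace Summit.ValiantsHypothesis.ValiantsHypothesis.Theorems.DetQPDetqpThesis.HdCalibration

set_option linter.dupNamespace false

open Literature.Computability.AlgebraicComplexity
open Summit.ValiantsHypothesis.ValiantsHypothesis.Theorems.DetQPDetqpThesis
  (stub_stabH stub_torusLimit_general stub_sequentialApolarity)
open Summit.ValiantsHypothesis.ValiantsHypothesis.Theorems.DetQPDetqpThesis.HdBorelFixed (hd_borelFixed_of_parts hd_weightH)

/-- **B2 — Borel-fixed witnesses for the padded four-dimensional determinant**, from the parts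
(B2w as the hypothesis `hW`; B2s, B2t, B2d landed). -/
theorem hdc2_borelFixedWitness
    (hW : ∀ (n m : ℕ) [NeZero m] (ι : (Fin 4 → Fin n) → Fin m × Fin m), Function.Injective ι →
      ((0 : Fin m), (0 : Fin m)) ∉ Set.range ι →
      ∃ μ : Fin m × Fin m → ℤ,
        (∀ v, 0 ≤ μ v) ∧
        Function.Injective μ ∧
        (∀ I I' : Fin 4 → Fin n, (∀ r, I' r ≤ I r) → I ≠ I' → μ (ι I) < μ (ι I')) ∧
        (∀ p : Fin m × Fin m, p ∉ Set.range ι → p ≠ (0, 0) → ∀ I : Fin 4 → Fin n, μ p < μ (ι I)) ∧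
        (∀ p : Fin m × Fin m, p ∉ Set.range ι → p ≠ (0, 0) → μ p < μ (0, 0)) ∧
        (∀ p q : Fin m × Fin m, p ∉ Set.range ι → p ≠ (0, 0) → q ∉ Set.range ι → q ≠ (0, 0) →
          (p.1 : ℕ) * m + (p.2 : ℕ) < (q.1 : ℕ) * m + (q.2 : ℕ) → μ q < μ p) ∧
        (∃ ν₀ : ℤ, ∀ d ∈ (X ((0 : Fin m), (0 : Fin m)) ^ (m - n) *
            rename ι (hyperdet fun I : Fin 4 → Fin n => (X I : MvPolynomial (Fin 4 → Fin n) ℂ))).support,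
          Finsupp.weight μ d = ν₀) ∧
        (∀ e e' : Fin m × Fin m →₀ ℕ, e.degree ≤ m → e'.degree ≤ m →
          Finsupp.weight μ e = Finsupp.weight μ e' →
          ∀ d : Fin m × Fin m → ℂ, (∀ v, d v ≠ 0) →
            (∃ t : Fin 4 → Fin n → ℂ, ∀ I : Fin 4 → Fin n, d (ι I) = ∏ r, t r (I r)) →
            ∏ v ∈ e.support, d v ^ e v = ∏ v ∈ e'.support, d v ^ e' v) ∧
        (∃ hi : ℤ, ∀ e : Fin m × Fin m →₀ ℕ, e.degree ≤ m → Finsupp.weight μ e ≤ hi))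
    (n m : ℕ) [NeZero m] (hn : 1 ≤ n) (hnm : n ≤ m)
    (ι : (Fin 4 → Fin n) → Fin m × Fin m) (hι : Function.Injective ι)
    (hℓ : ((0 : Fin m), (0 : Fin m)) ∉ Set.range ι)
    (h : ∃ (P : ℕ → MvPolynomial (Fin m × Fin m) ℂ) (J : ℕ → Set (MvPolynomial (Fin m × Fin m) ℂ)),
      (∀ t : ℕ, P t ∈ glOrbit (Fin m × Fin m) ℂ (detPoly (Fin m) ℂ)) ∧
      IsBorderApolarLimit m P J ∧
      (∀ k ≤ m, ∀ D ∈ J k, apolarAction D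
        (X ((0 : Fin m), (0 : Fin m)) ^ (m - n) *
          rename ι (hyperdet fun I : Fin 4 → Fin n => (X I : MvPolynomial (Fin 4 → Fin n) ℂ))) = 0)) :
    ∃ (P : ℕ → MvPolynomial (Fin m × Fin m) ℂ) (J : ℕ → Set (MvPolynomial (Fin m × Fin m) ℂ)),
      (∀ t : ℕ, P t ∈ glOrbit (Fin m × Fin m) ℂ (detPoly (Fin m) ℂ)) ∧
      IsBorderApolarLimit m P J ∧
      (∀ A : Matrix.GeneralLinearGroup (Fin m × Fin m) ℂ,
        let M : Matrix (Fin m × Fin m) (Fin m × Fin m) ℂ := A;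
        (∃ a : Fin 4 → Matrix (Fin n) (Fin n) ℂ,
            (∀ (r : Fin 4) (i j : Fin n), j < i → a r i j = 0) ∧
            (∀ I I' : Fin 4 → Fin n, M (ι I') (ι I) = ∏ r, a r (I' r) (I r)) ∧
            M (0, 0) (0, 0) ^ (m - n) * ∏ r, ∏ i, a r i i = 1) →
        (∀ (I : Fin 4 → Fin n) (p : Fin m × Fin m), p ∉ Set.range ι → M p (ι I) = 0) →
        (∀ p : Fin m × Fin m, p ≠ (0, 0) → M p (0, 0) = 0) →
        (∀ p q : Fin m × Fin m, p ∉ Set.range ι → p ≠ (0, 0) → q ∉ Set.range ι → q ≠ (0, 0) →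
            (p.1 : ℕ) * m + (p.2 : ℕ) < (q.1 : ℕ) * m + (q.2 : ℕ) → M q p = 0) →
        ∀ k ≤ m, ∀ D ∈ J k, linSubst (Fin m × Fin m) ℂ Mᵀ D ∈ J k) ∧
      (∀ k ≤ m, ∀ D ∈ J k, apolarAction D
        (X ((0 : Fin m), (0 : Fin m)) ^ (m - n) *
          rename ι (hyperdet fun I : Fin 4 → Fin n => (X I : MvPolynomial (Fin 4 → Fin n) ℂ))) = 0) :=
  hd_borelFixed_of_parts n m hn hnm ι hι hℓ (hW n m ι hι hℓ)
    (fun M h1 h2 h3 => stub_stabH n m ι hι hℓ M h1 h2 h3)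
    (fun f P hP J hJ hJf μ ν₀ hμ => stub_torusLimit_general f P hP J hJ hJf μ ν₀ hμ) h

/-- **`HdBorderThesis ⇒ C`** (unconditional): a stable witness would give membership
(`hdc_mem_of_fixedWitness`). -/
theorem hdc2_hdBorderThesis_imp_noFixedWitnessQP
    (hB : ∀ c : ℕ, ∃ n₀ : ℕ, ∀ n ≥ n₀, ∀ (m : ℕ) [NeZero m], n ^ 2 + 1 ≤ m →
      m ≤ 2 ^ ((Nat.log 2 n + c) ^ c) →
      ∀ ι : (Fin 4 → Fin n) → Fin m × Fin m, Function.Injective ι →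
        ((0 : Fin m), (0 : Fin m)) ∉ Set.range ι →
        X ((0 : Fin m), (0 : Fin m)) ^ (m - n) *
            rename ι (hyperdet fun I : Fin 4 → Fin n => (X I : MvPolynomial (Fin 4 → Fin n) ℂ)) ∉
          orbitClosure (detPoly (Fin m) ℂ)) :
    ∀ c : ℕ, ∃ n₀ : ℕ, ∀ n ≥ n₀, ∀ (m : ℕ) [NeZero m], n ^ 2 + 1 ≤ m →
      m ≤ 2 ^ ((Nat.log 2 n + c) ^ c) →
      ∀ ι : (Fin 4 → Fin n) → Fin m × Fin m, Function.Injective ι →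
        ((0 : Fin m), (0 : Fin m)) ∉ Set.range ι →
        ¬ ∃ (P : ℕ → MvPolynomial (Fin m × Fin m) ℂ) (J : ℕ → Set (MvPolynomial (Fin m × Fin m) ℂ)),
          (∀ t : ℕ, P t ∈ glOrbit (Fin m × Fin m) ℂ (detPoly (Fin m) ℂ)) ∧
          IsBorderApolarLimit m P J ∧
          (∀ A : Matrix.GeneralLinearGroup (Fin m × Fin m) ℂ,
            let M : Matrix (Fin m × Fin m) (Fin m × Fin m) ℂ := A;
            (∃ a : Fin 4 → Matrix (Fin n) (Fin n) ℂ,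
                (∀ (r : Fin 4) (i j : Fin n), j < i → a r i j = 0) ∧
                (∀ I I' : Fin 4 → Fin n, M (ι I') (ι I) = ∏ r, a r (I' r) (I r)) ∧
                M (0, 0) (0, 0) ^ (m - n) * ∏ r, ∏ i, a r i i = 1) →
            (∀ (I : Fin 4 → Fin n) (p : Fin m × Fin m), p ∉ Set.range ι → M p (ι I) = 0) →
            (∀ p : Fin m × Fin m, p ≠ (0, 0) → M p (0, 0) = 0) →
            (∀ p q : Fin m × Fin m, p ∉ Set.range ι → p ≠ (0, 0) → q ∉ Set.range ι → q ≠ (0, 0) →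
                (p.1 : ℕ) * m + (p.2 : ℕ) < (q.1 : ℕ) * m + (q.2 : ℕ) → M q p = 0) →
            ∀ k ≤ m, ∀ D ∈ J k, linSubst (Fin m × Fin m) ℂ Mᵀ D ∈ J k) ∧
          (∀ k ≤ m, ∀ D ∈ J k, apolarAction D
            (X ((0 : Fin m), (0 : Fin m)) ^ (m - n) *
              rename ι (hyperdet fun I : Fin 4 → Fin n => (X I : MvPolynomial (Fin 4 → Fin n) ℂ))) = 0) := by
  intro c
  obtain ⟨n₀, hn₀⟩ := hB c
  refine ⟨n₀, fun n hn m _ hm hmc ι hι hℓ hwit => ?_⟩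
  have hnm : n ≤ m := by nlinarith
  exact hn₀ n hn m hm hmc ι hι hℓ (hdc_mem_of_fixedWitness hnm ι hι hwit)

/-- **`C ⇒ HdBorderThesis`** (modulo B2w): membership gives a plain witness (B1), hence an
`H(n,m,ι)`-stable one (B2), contradicting C. -/
theorem hdc2_noFixedWitnessQP_imp_hdBorderThesis
    (hW : ∀ (n m : ℕ) [NeZero m] (ι : (Fin 4 → Fin n) → Fin m × Fin m), Function.Injective ι →
      ((0 : Fin m), (0 : Fin m)) ∉ Set.range ι →
      ∃ μ : Fin m × Fin m → ℤ,
        (∀ v, 0 ≤ μ v) ∧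
        Function.Injective μ ∧
        (∀ I I' : Fin 4 → Fin n, (∀ r, I' r ≤ I r) → I ≠ I' → μ (ι I) < μ (ι I')) ∧
        (∀ p : Fin m × Fin m, p ∉ Set.range ι → p ≠ (0, 0) → ∀ I : Fin 4 → Fin n, μ p < μ (ι I)) ∧
        (∀ p : Fin m × Fin m, p ∉ Set.range ι → p ≠ (0, 0) → μ p < μ (0, 0)) ∧
        (∀ p q : Fin m × Fin m, p ∉ Set.range ι → p ≠ (0, 0) → q ∉ Set.range ι → q ≠ (0, 0) →
          (p.1 : ℕ) * m + (p.2 : ℕ) < (q.1 : ℕ) * m + (q.2 : ℕ) → μ q < μ p) ∧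
        (∃ ν₀ : ℤ, ∀ d ∈ (X ((0 : Fin m), (0 : Fin m)) ^ (m - n) *
            rename ι (hyperdet fun I : Fin 4 → Fin n => (X I : MvPolynomial (Fin 4 → Fin n) ℂ))).support,
          Finsupp.weight μ d = ν₀) ∧
        (∀ e e' : Fin m × Fin m →₀ ℕ, e.degree ≤ m → e'.degree ≤ m →
          Finsupp.weight μ e = Finsupp.weight μ e' →
          ∀ d : Fin m × Fin m → ℂ, (∀ v, d v ≠ 0) →
            (∃ t : Fin 4 → Fin n → ℂ, ∀ I : Fin 4 → Fin n, d (ι I) = ∏ r, t r (I r)) →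
            ∏ v ∈ e.support, d v ^ e v = ∏ v ∈ e'.support, d v ^ e' v) ∧
        (∃ hi : ℤ, ∀ e : Fin m × Fin m →₀ ℕ, e.degree ≤ m → Finsupp.weight μ e ≤ hi))
    (hC : ∀ c : ℕ, ∃ n₀ : ℕ, ∀ n ≥ n₀, ∀ (m : ℕ) [NeZero m], n ^ 2 + 1 ≤ m →
      m ≤ 2 ^ ((Nat.log 2 n + c) ^ c) →
      ∀ ι : (Fin 4 → Fin n) → Fin m × Fin m, Function.Injective ι →
        ((0 : Fin m), (0 : Fin m)) ∉ Set.range ι →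
        ¬ ∃ (P : ℕ → MvPolynomial (Fin m × Fin m) ℂ) (J : ℕ → Set (MvPolynomial (Fin m × Fin m) ℂ)),
          (∀ t : ℕ, P t ∈ glOrbit (Fin m × Fin m) ℂ (detPoly (Fin m) ℂ)) ∧
          IsBorderApolarLimit m P J ∧
          (∀ A : Matrix.GeneralLinearGroup (Fin m × Fin m) ℂ,
            let M : Matrix (Fin m × Fin m) (Fin m × Fin m) ℂ := A;
            (∃ a : Fin 4 → Matrix (Fin n) (Fin n) ℂ,
                (∀ (r : Fin 4) (i j : Fin n), j < i → a r i j = 0) ∧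
                (∀ I I' : Fin 4 → Fin n, M (ι I') (ι I) = ∏ r, a r (I' r) (I r)) ∧
                M (0, 0) (0, 0) ^ (m - n) * ∏ r, ∏ i, a r i i = 1) →
            (∀ (I : Fin 4 → Fin n) (p : Fin m × Fin m), p ∉ Set.range ι → M p (ι I) = 0) →
            (∀ p : Fin m × Fin m, p ≠ (0, 0) → M p (0, 0) = 0) →
            (∀ p q : Fin m × Fin m, p ∉ Set.range ι → p ≠ (0, 0) → q ∉ Set.range ι → q ≠ (0, 0) →
                (p.1 : ℕ) * m + (p.2 : ℕ) < (q.1 : ℕ) * m + (q.2 : ℕ) → M q p = 0) →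
            ∀ k ≤ m, ∀ D ∈ J k, linSubst (Fin m × Fin m) ℂ Mᵀ D ∈ J k) ∧
          (∀ k ≤ m, ∀ D ∈ J k, apolarAction D
            (X ((0 : Fin m), (0 : Fin m)) ^ (m - n) *
              rename ι (hyperdet fun I : Fin 4 → Fin n => (X I : MvPolynomial (Fin 4 → Fin n) ℂ))) = 0)) :
    ∀ c : ℕ, ∃ n₀ : ℕ, ∀ n ≥ n₀, ∀ (m : ℕ) [NeZero m], n ^ 2 + 1 ≤ m →
      m ≤ 2 ^ ((Nat.log 2 n + c) ^ c) →
      ∀ ι : (Fin 4 → Fin n) → Fin m × Fin m, Function.Injective ι →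
        ((0 : Fin m), (0 : Fin m)) ∉ Set.range ι →
        X ((0 : Fin m), (0 : Fin m)) ^ (m - n) *
            rename ι (hyperdet fun I : Fin 4 → Fin n => (X I : MvPolynomial (Fin 4 → Fin n) ℂ)) ∉
          orbitClosure (detPoly (Fin m) ℂ) := by
  intro c
  obtain ⟨n₀, hn₀⟩ := hC c
  refine ⟨max n₀ 1, fun n hn m _ hm hmc ι hι hℓ hmem => ?_⟩
  have hn1 : 1 ≤ n := le_of_max_le_right hn
  have hnm : n ≤ m := by nlinarith
  exact hn₀ n (le_of_max_le_left hn) m hm hmc ι hι hℓ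
    (hdc2_borelFixedWitness hW n m hn1 hnm ι hι hℓ (stub_sequentialApolarity _ hmem))

/-- **The line's bet C (`stub_noFixedWitnessQP`) is EQUIVALENT to `GCTMult.GctThesis`** (crux
stmt-ValiantsHypothesis-0323 of route GCTMult), modulo B2w (`stub_weightH`, hypothesis `hW`). -/
theorem hdc2_noFixedWitnessQP_iff_gctThesis
    (hW : ∀ (n m : ℕ) [NeZero m] (ι : (Fin 4 → Fin n) → Fin m × Fin m), Function.Injective ι →
      ((0 : Fin m), (0 : Fin m)) ∉ Set.range ι →
      ∃ μ : Fin m × Fin m → ℤ,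
        (∀ v, 0 ≤ μ v) ∧
        Function.Injective μ ∧
        (∀ I I' : Fin 4 → Fin n, (∀ r, I' r ≤ I r) → I ≠ I' → μ (ι I) < μ (ι I')) ∧
        (∀ p : Fin m × Fin m, p ∉ Set.range ι → p ≠ (0, 0) → ∀ I : Fin 4 → Fin n, μ p < μ (ι I)) ∧
        (∀ p : Fin m × Fin m, p ∉ Set.range ι → p ≠ (0, 0) → μ p < μ (0, 0)) ∧
        (∀ p q : Fin m × Fin m, p ∉ Set.range ι → p ≠ (0, 0) → q ∉ Set.range ι → q ≠ (0, 0) →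
          (p.1 : ℕ) * m + (p.2 : ℕ) < (q.1 : ℕ) * m + (q.2 : ℕ) → μ q < μ p) ∧
        (∃ ν₀ : ℤ, ∀ d ∈ (X ((0 : Fin m), (0 : Fin m)) ^ (m - n) *
            rename ι (hyperdet fun I : Fin 4 → Fin n => (X I : MvPolynomial (Fin 4 → Fin n) ℂ))).support,
          Finsupp.weight μ d = ν₀) ∧
        (∀ e e' : Fin m × Fin m →₀ ℕ, e.degree ≤ m → e'.degree ≤ m →
          Finsupp.weight μ e = Finsupp.weight μ e' →
          ∀ d : Fin m × Fin m → ℂ, (∀ v, d v ≠ 0) →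
            (∃ t : Fin 4 → Fin n → ℂ, ∀ I : Fin 4 → Fin n, d (ι I) = ∏ r, t r (I r)) →
            ∏ v ∈ e.support, d v ^ e v = ∏ v ∈ e'.support, d v ^ e' v) ∧
        (∃ hi : ℤ, ∀ e : Fin m × Fin m →₀ ℕ, e.degree ≤ m → Finsupp.weight μ e ≤ hi)) :
    (∀ c : ℕ, ∃ n₀ : ℕ, ∀ n ≥ n₀, ∀ (m : ℕ) [NeZero m], n ^ 2 + 1 ≤ m →
      m ≤ 2 ^ ((Nat.log 2 n + c) ^ c) →
      ∀ ι : (Fin 4 → Fin n) → Fin m × Fin m, Function.Injective ι →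
        ((0 : Fin m), (0 : Fin m)) ∉ Set.range ι →
        ¬ ∃ (P : ℕ → MvPolynomial (Fin m × Fin m) ℂ) (J : ℕ → Set (MvPolynomial (Fin m × Fin m) ℂ)),
          (∀ t : ℕ, P t ∈ glOrbit (Fin m × Fin m) ℂ (detPoly (Fin m) ℂ)) ∧
          IsBorderApolarLimit m P J ∧
          (∀ A : Matrix.GeneralLinearGroup (Fin m × Fin m) ℂ,
            let M : Matrix (Fin m × Fin m) (Fin m × Fin m) ℂ := A;
            (∃ a : Fin 4 → Matrix (Fin n) (Fin n) ℂ,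
                (∀ (r : Fin 4) (i j : Fin n), j < i → a r i j = 0) ∧
                (∀ I I' : Fin 4 → Fin n, M (ι I') (ι I) = ∏ r, a r (I' r) (I r)) ∧
                M (0, 0) (0, 0) ^ (m - n) * ∏ r, ∏ i, a r i i = 1) →
            (∀ (I : Fin 4 → Fin n) (p : Fin m × Fin m), p ∉ Set.range ι → M p (ι I) = 0) →
            (∀ p : Fin m × Fin m, p ≠ (0, 0) → M p (0, 0) = 0) →
            (∀ p q : Fin m × Fin m, p ∉ Set.range ι → p ≠ (0, 0) → q ∉ Set.range ι → q ≠ (0, 0) →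
                (p.1 : ℕ) * m + (p.2 : ℕ) < (q.1 : ℕ) * m + (q.2 : ℕ) → M q p = 0) →
            ∀ k ≤ m, ∀ D ∈ J k, linSubst (Fin m × Fin m) ℂ Mᵀ D ∈ J k) ∧
          (∀ k ≤ m, ∀ D ∈ J k, apolarAction D
            (X ((0 : Fin m), (0 : Fin m)) ^ (m - n) *
              rename ι (hyperdet fun I : Fin 4 → Fin n => (X I : MvPolynomial (Fin 4 → Fin n) ℂ))) = 0)) ↔
    Summit.ValiantsHypothesis.ValiantsHypothesis.Theses.GCTMult.GctThesis :=
  ⟨fun hC => hdc2_hdBorderThesis_imp_gctThesis (hdc2_noFixedWitnessQP_imp_hdBorderThesis hW hC),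
    fun hG => hdc2_hdBorderThesis_imp_noFixedWitnessQP (hdc2_gctThesis_imp_hdBorderThesis hG)⟩

/-- **B2 — Borel-fixed witnesses for the padded four-dimensional determinant** (the crux-plan's
`stub_borelFixedWitness`, unconditional). -/
theorem hd_borelFixedWitness (n m : ℕ) [NeZero m] (hn : 1 ≤ n) (hnm : n ≤ m)
    (ι : (Fin 4 → Fin n) → Fin m × Fin m) (hι : Function.Injective ι)
    (hℓ : ((0 : Fin m), (0 : Fin m)) ∉ Set.range ι)
    (h : ∃ (P : ℕ → MvPolynomial (Fin m × Fin m) ℂ) (J : ℕ → Set (MvPolynomial (Fin m × Fin m) ℂ)),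
      (∀ t : ℕ, P t ∈ glOrbit (Fin m × Fin m) ℂ (detPoly (Fin m) ℂ)) ∧
      IsBorderApolarLimit m P J ∧
      (∀ k ≤ m, ∀ D ∈ J k, apolarAction D
        (X ((0 : Fin m), (0 : Fin m)) ^ (m - n) *
          rename ι (hyperdet fun I : Fin 4 → Fin n => (X I : MvPolynomial (Fin 4 → Fin n) ℂ))) = 0)) :
    ∃ (P : ℕ → MvPolynomial (Fin m × Fin m) ℂ) (J : ℕ → Set (MvPolynomial (Fin m × Fin m) ℂ)),
      (∀ t : ℕ, P t ∈ glOrbit (Fin m × Fin m) ℂ (detPoly (Fin m) ℂ)) ∧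
      IsBorderApolarLimit m P J ∧
      (∀ A : Matrix.GeneralLinearGroup (Fin m × Fin m) ℂ,
        let M : Matrix (Fin m × Fin m) (Fin m × Fin m) ℂ := A;
        (∃ a : Fin 4 → Matrix (Fin n) (Fin n) ℂ,
            (∀ (r : Fin 4) (i j : Fin n), j < i → a r i j = 0) ∧
            (∀ I I' : Fin 4 → Fin n, M (ι I') (ι I) = ∏ r, a r (I' r) (I r)) ∧
            M (0, 0) (0, 0) ^ (m - n) * ∏ r, ∏ i, a r i i = 1) →
        (∀ (I : Fin 4 → Fin n) (p : Fin m × Fin m), p ∉ Set.range ι → M p (ι I) = 0) →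
        (∀ p : Fin m × Fin m, p ≠ (0, 0) → M p (0, 0) = 0) →
        (∀ p q : Fin m × Fin m, p ∉ Set.range ι → p ≠ (0, 0) → q ∉ Set.range ι → q ≠ (0, 0) →
            (p.1 : ℕ) * m + (p.2 : ℕ) < (q.1 : ℕ) * m + (q.2 : ℕ) → M q p = 0) →
        ∀ k ≤ m, ∀ D ∈ J k, linSubst (Fin m × Fin m) ℂ Mᵀ D ∈ J k) ∧
      (∀ k ≤ m, ∀ D ∈ J k, apolarAction D
        (X ((0 : Fin m), (0 : Fin m)) ^ (m - n) *
          rename ι (hyperdet fun I : Fin 4 → Fin n => (X I : MvPolynomial (Fin 4 → Fin n) ℂ))) = 0) :=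
  hdc2_borelFixedWitness (fun n m _ ι hι hℓ => hd_weightH n m ι hι hℓ) n m hn hnm ι hι hℓ h

/-- **`H(n,m,ι)`-stable witnesses ⇔ membership**: for `1 ≤ n ≤ m` and an injective placement
missing `(0,0)`, an `H(n,m,ι)`-stable border-apolar witness inside `Ann(X₀₀^{m-n} H_n(X_ι))` exists
iff `X₀₀^{m-n} H_n(X_ι) ∈ Δ(det_m)` (B1 + B2 one way, the degree-`m` pairing the other). -/
theorem hd_fixedWitness_iff_mem {n m : ℕ} [NeZero m] (hn : 1 ≤ n) (hnm : n ≤ m)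
    (ι : (Fin 4 → Fin n) → Fin m × Fin m) (hι : Function.Injective ι)
    (hℓ : ((0 : Fin m), (0 : Fin m)) ∉ Set.range ι) :
    (∃ (P : ℕ → MvPolynomial (Fin m × Fin m) ℂ) (J : ℕ → Set (MvPolynomial (Fin m × Fin m) ℂ)),
      (∀ t : ℕ, P t ∈ glOrbit (Fin m × Fin m) ℂ (detPoly (Fin m) ℂ)) ∧
      IsBorderApolarLimit m P J ∧
      (∀ A : Matrix.GeneralLinearGroup (Fin m × Fin m) ℂ,
        let M : Matrix (Fin m × Fin m) (Fin m × Fin m) ℂ := A;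
        (∃ a : Fin 4 → Matrix (Fin n) (Fin n) ℂ,
            (∀ (r : Fin 4) (i j : Fin n), j < i → a r i j = 0) ∧
            (∀ I I' : Fin 4 → Fin n, M (ι I') (ι I) = ∏ r, a r (I' r) (I r)) ∧
            M (0, 0) (0, 0) ^ (m - n) * ∏ r, ∏ i, a r i i = 1) →
        (∀ (I : Fin 4 → Fin n) (p : Fin m × Fin m), p ∉ Set.range ι → M p (ι I) = 0) →
        (∀ p : Fin m × Fin m, p ≠ (0, 0) → M p (0, 0) = 0) →
        (∀ p q : Fin m × Fin m, p ∉ Set.range ι → p ≠ (0, 0) → q ∉ Set.range ι → q ≠ (0, 0) →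
            (p.1 : ℕ) * m + (p.2 : ℕ) < (q.1 : ℕ) * m + (q.2 : ℕ) → M q p = 0) →
        ∀ k ≤ m, ∀ D ∈ J k, linSubst (Fin m × Fin m) ℂ Mᵀ D ∈ J k) ∧
      (∀ k ≤ m, ∀ D ∈ J k, apolarAction D
        (X ((0 : Fin m), (0 : Fin m)) ^ (m - n) *
          rename ι (hyperdet fun I : Fin 4 → Fin n => (X I : MvPolynomial (Fin 4 → Fin n) ℂ))) = 0)) ↔
    X ((0 : Fin m), (0 : Fin m)) ^ (m - n) *
        rename ι (hyperdet fun I : Fin 4 → Fin n => (X I : MvPolynomial (Fin 4 → Fin n) ℂ)) ∈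
      orbitClosure (detPoly (Fin m) ℂ) :=
  ⟨fun h => hdc_mem_of_fixedWitness hnm ι hι h,
    fun hmem => hd_borelFixedWitness n m hn hnm ι hι hℓ (stub_sequentialApolarity _ hmem)⟩

/-- **The line's bet C (`stub_noFixedWitnessQP`, statement verbatim) is EQUIVALENT to
`GCTMult.GctThesis`** (crux stmt-ValiantsHypothesis-0323 of route GCTMult), unconditionally. -/
theorem hd_noFixedWitnessQP_iff_gctThesis :
    (∀ c : ℕ, ∃ n₀ : ℕ, ∀ n ≥ n₀, ∀ (m : ℕ) [NeZero m], n ^ 2 + 1 ≤ m →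
      m ≤ 2 ^ ((Nat.log 2 n + c) ^ c) →
      ∀ ι : (Fin 4 → Fin n) → Fin m × Fin m, Function.Injective ι →
        ((0 : Fin m), (0 : Fin m)) ∉ Set.range ι →
        ¬ ∃ (P : ℕ → MvPolynomial (Fin m × Fin m) ℂ) (J : ℕ → Set (MvPolynomial (Fin m × Fin m) ℂ)),
          (∀ t : ℕ, P t ∈ glOrbit (Fin m × Fin m) ℂ (detPoly (Fin m) ℂ)) ∧
          IsBorderApolarLimit m P J ∧
          (∀ A : Matrix.GeneralLinearGroup (Fin m × Fin m) ℂ,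
            let M : Matrix (Fin m × Fin m) (Fin m × Fin m) ℂ := A;
            (∃ a : Fin 4 → Matrix (Fin n) (Fin n) ℂ,
                (∀ (r : Fin 4) (i j : Fin n), j < i → a r i j = 0) ∧
                (∀ I I' : Fin 4 → Fin n, M (ι I') (ι I) = ∏ r, a r (I' r) (I r)) ∧
                M (0, 0) (0, 0) ^ (m - n) * ∏ r, ∏ i, a r i i = 1) →
            (∀ (I : Fin 4 → Fin n) (p : Fin m × Fin m), p ∉ Set.range ι → M p (ι I) = 0) →
            (∀ p : Fin m × Fin m, p ≠ (0, 0) → M p (0, 0) = 0) →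
            (∀ p q : Fin m × Fin m, p ∉ Set.range ι → p ≠ (0, 0) → q ∉ Set.range ι → q ≠ (0, 0) →
                (p.1 : ℕ) * m + (p.2 : ℕ) < (q.1 : ℕ) * m + (q.2 : ℕ) → M q p = 0) →
            ∀ k ≤ m, ∀ D ∈ J k, linSubst (Fin m × Fin m) ℂ Mᵀ D ∈ J k) ∧
          (∀ k ≤ m, ∀ D ∈ J k, apolarAction D
            (X ((0 : Fin m), (0 : Fin m)) ^ (m - n) *
              rename ι (hyperdet fun I : Fin 4 → Fin n => (X I : MvPolynomial (Fin 4 → Fin n) ℂ))) = 0)) ↔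
    Summit.ValiantsHypothesis.ValiantsHypothesis.Theses.GCTMult.GctThesis := by
  exact hdc2_noFixedWitnessQP_iff_gctThesis (fun n m _ ι hι hℓ => hd_weightH n m ι hι hℓ)

end Summit.ValiantsHypothesis.ValiantsHypothesis.Theorems.DetQPDetqpThesis.HdCalibration
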